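import Literature.NumberTheory.Automorphic.ReciprocityGLnCor93Proofs
import Literature.NumberTheory.GaloisRepresentations.HeckeCharacterProofs
import Literature.NumberTheory.EllipticCurves.NewformGaloisRep
import HarnessLib

/-!
# Deligne's theorem in `ℚ̄_ℓ`-form from lang.S27 and the adelic dictionary for eigenforms

A proofs-only file (theorems only: no definitions, no named facts; D-0026), written by the seat of
the named fact `Literature.NumberTheory.EllipticCurves.ModularForms.DeligneSerre1974.thm67_weightOne`
(Deligne–Serre 1974, Thm. 6.7 in weight one), whose proof in the tree is complete modulo Deligne's
theorem (op. cit. Thm. 6.1) at every finite place. The companion file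
`NewformGaloisRepModLOfPadicAlgClProofs` reduces Thm. 6.7 to Deligne's theorem in the
**`ℚ̄_ℓ`-form** of the tree's Langlands cone — for every cuspidal eigenform `g ∈ S_k(Γ₁(M), χ)`,
`k ≥ 2`, with `T_p`-eigenvalues `a_p ∈ ℂ` (`p ∤ M`), every prime `ℓ` and every `ι : ℚ̄_ℓ ≃+* ℂ`,
a continuous semisimple `r : Gal(ℚ̄/ℚ) → GL₂(ℚ̄_ℓ)` unramified at `p ∤ M`, `p ≠ ℓ`, whose
arithmetic Frobenii there have characteristic polynomial `X² - ι⁻¹(a_p) X + ι⁻¹(χ(p) p^{k-1})`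
(`thm67_weightOne_of_deligne_padicAlgCl'`). Here that statement is derived from the tree's
**lang.S27** (`Literature.NumberTheory.Automorphic.exists_galoisRep_of_regularAlgebraic`:
Harris–Lan–Taylor–Thorne 2016, Thm. A with Varma; over `ℚ` already from the existence half of
Thm. A, `exists_galoisRep_of_regularAlgebraic_rat_of`) and ONE hypothesis `hdict`, the adelic
dictionary for eigenforms of weight `≥ 2` in the tree's Borel–Jacquet vocabulary
(`CuspidalAutomorphicRepData`, `IsRegularAlgebraic`, `HasSatakeParamAt`): every such `g` gives a
regular algebraic cuspidal automorphic representation `π` of `GL₂(𝔸_ℚ)` whose Satake parameter at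
`p ∤ M` is `{(√p β₁)⁻¹, (√p β₂)⁻¹}`, `β₁, β₂` the roots of the Hecke polynomial
`X² - a_p X + χ(p) p^{k-1}` — i.e. `π = π_g ⊗ (χ⁻¹ |·|^{k/2}) ∘ det` for the unitary `π_g`
generated by the adelic lift of `g` (Gelbart 1975, §3, Prop. 3.1 and Lemma 3.7; Bump 1997,
Thm. 3.6.1; with `π_∞` of Harish-Chandra parameter `{k - 1/2, 1/2}`, regular and C-algebraic,
Clozel 1990, §1.2, 3.5), the normalisation for which Harris–Lan–Taylor–Thorne's
`arithFrobPolyOfSatake ι p 2 {(√p β_j)⁻¹} = ∏_j (X - ι⁻¹(β_j))` is exactly Deligne's polynomial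
(`arithFrobPolyOfSatake_heckeRoots`). The tree proves the finite part of this dictionary
(`NewformAdelisation*`, `Gelbart1975_exists_isAutomorphicRepOf_of_adelicLift`,
`AutomorphicRepsGL.exists_cuspidalRepData_of_L2_holds`, `hasSatakeParamAt_of_eigenvector`) but
not yet its archimedean half (the Harish-Chandra parameter of the representation generated by a
holomorphic lift), so `hdict` stays a hypothesis of the theorems below; nothing is vendored.

* `natCast_not_mem_asIdeal_of_primesEquiv_ne` — `ℓ ∉ w` for the place `w` of `ℚ` over `p ≠ ℓ`;
* `arithFrobPolyOfSatake_heckeRoots` — the normalisation identity above;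
* `deligne_padicAlgCl_of_theoremA_of_dictionary`, `deligne_padicAlgCl_of_langS27_of_dictionary`
  — Deligne's theorem in `ℚ̄_ℓ`-form from Harris–Lan–Taylor–Thorne's Thm. A (existence) resp.
  lang.S27, and `hdict`. Composed with `thm67_weightOne_of_deligne_padicAlgCl'` they close
  `thm67_weightOne` modulo the named fact `HarrisLanTaylorThorne2016.theoremA_existence` and
  `hdict`.

## References

* P. Deligne, J.-P. Serre, *Formes modulaires de poids 1*, Ann. Sci. ÉNS (4) 7 (1974), Thm. 6.1
  (p. 520), Thm. 6.7 (p. 521). [DeligneSerreASENS1974]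
* M. Harris, K.-W. Lan, R. Taylor, J. Thorne, *On the rigid cohomology of certain Shimura
  varieties*, Res. Math. Sci. 3 (2016), Thm. A (p. 3). [HarrisLanTaylorThorneRMS2016]
* S. Gelbart, *Automorphic forms on adele groups*, Ann. of Math. Stud. 83 (1975), §3, Prop. 3.1,
  Lemma 3.7; D. Bump, *Automorphic Forms and Representations* (1997), §3.6, Thm. 3.6.1. [Gelbart1975]
* L. Clozel, *Motifs et formes automorphes* (1990), §1.2, §3.3–3.5. [Clozel1990]
-/

noncomputable section

open scoped MatrixGroups ModularForm NumberField Polynomial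

open CongruenceSubgroup IsDedekindDomain Polynomial Rat.HeightOneSpectrum
  Literature.NumberTheory.Automorphic Literature.NumberTheory.GaloisRepresentations

namespace Literature.NumberTheory.EllipticCurves.ModularForms.DeligneSerre1974

/-! ### Places of `ℚ` and the Harris–Lan–Taylor–Thorne normalisation -/

/-- For a finite place `w` of `ℚ` over the prime `p_w ≠ ℓ`, `ℓ ∉ w`
(`Rat.natCast_mem_asIdeal_iff`: `n ∈ w ↔ p_w ∣ n`). [folklore] -/
theorem natCast_not_mem_asIdeal_of_primesEquiv_ne {w : HeightOneSpectrum (𝓞 ℚ)} {ℓ : ℕ}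
    (hℓ : ℓ.Prime) (h : ((primesEquiv w : Nat.Primes) : ℕ) ≠ ℓ) :
    ((ℓ : ℕ) : 𝓞 ℚ) ∉ w.asIdeal := by
  intro hmem
  rw [Rat.natCast_mem_asIdeal_iff] at hmem
  have h1 : natGenerator w = ℓ :=
    (Nat.prime_dvd_prime_iff_eq (prime_natGenerator w) hℓ).mp hmem
  exact h h1

/-- **The Harris–Lan–Taylor–Thorne polynomial of the Satake parameter `{(√q β)⁻¹ : β}` is
`∏_β (X - ι⁻¹(β))`.** For `ι : ℚ̄_ℓ ≃+* ℂ`, `q > 0` and a monic `P ∈ ℂ[X]` (which splits, `ℂ` being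
algebraically closed) with roots `β`, the predicted characteristic polynomial of arithmetic
Frobenius `arithFrobPolyOfSatake ι q 2 (P.roots.map (β ↦ (√q β)⁻¹)) = ∏_β (X - (ι⁻¹(√q (√q β)⁻¹))⁻¹)`
(`ReciprocityGLn`) equals `P.map ι⁻¹`: `√q (√q β)⁻¹ = β⁻¹` and `(ι⁻¹(β⁻¹))⁻¹ = ι⁻¹(β)`. With
`P = X² - a_p X + χ(p) p^{k-1}` (arithmetic Frobenius eigenvalues `β_j` of `ρ_{g,λ}`,
Deligne–Serre 1974, Thm. 6.1) this is the dictionary between Harris–Lan–Taylor–Thorne's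
normalisation (geometric Frobenius eigenvalues `q^{(n-1)/2} α_j`, Thm. A) and Deligne's.
[cite: HarrisLanTaylorThorneRMS2016, Thm. A (p. 3)] -/
theorem arithFrobPolyOfSatake_heckeRoots {ℓ : ℕ} [Fact ℓ.Prime] (ι : PadicAlgCl ℓ ≃+* ℂ)
    {q : ℕ} (hq : 0 < q) {P : ℂ[X]} (hP : P.Monic) :
    arithFrobPolyOfSatake ι q 2 (P.roots.map fun β ↦ (((Real.sqrt q : ℝ) : ℂ) * β)⁻¹) =
      P.map (ι.symm : ℂ →+* PadicAlgCl ℓ) := by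
  have hsq : ((Real.sqrt q : ℝ) : ℂ) ≠ 0 := by
    rw [Ne, Complex.ofReal_eq_zero]
    exact (Real.sqrt_pos.mpr (by exact_mod_cast hq)).ne'
  -- the inner simplification `ι⁻¹((√q (√q β)⁻¹)⁻¹) = ι⁻¹ β`
  have hinner : ∀ β : ℂ,
      ι.symm ((((Real.sqrt q : ℝ) : ℂ)) ^ (2 - 1) * ((((Real.sqrt q : ℝ) : ℂ)) * β)⁻¹)⁻¹ =
        ι.symm β := by
    intro β
    have h1 : (((Real.sqrt q : ℝ) : ℂ)) ^ (2 - 1) * ((((Real.sqrt q : ℝ) : ℂ)) * β)⁻¹ = β⁻¹ := by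
      rw [show (2 - 1 : ℕ) = 1 from rfl, pow_one, mul_inv, ← mul_assoc, mul_inv_cancel₀ hsq, one_mul]
    rw [h1, inv_inv]
  unfold arithFrobPolyOfSatake
  rw [Multiset.map_map]
  have hcard : Multiset.card P.roots = P.natDegree :=
    Polynomial.splits_iff_card_roots.mp (IsAlgClosed.splits P)
  trans (P.roots.map fun β ↦ (X - C β).map (ι.symm : ℂ →+* PadicAlgCl ℓ)).prod
  · congr 1
    refine Multiset.map_congr rfl fun β _ ↦ ?_
    simp only [Function.comp_apply, Polynomial.map_sub, Polynomial.map_X, Polynomial.map_C]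
    rw [hinner]
    rfl
  · conv_rhs => rw [← Polynomial.prod_multiset_X_sub_C_of_monic_of_roots_card_eq hP hcard]
    rw [Polynomial.map_multiset_prod, Multiset.map_map]
    rfl

/-! ### Deligne's theorem in `ℚ̄_ℓ`-form from Thm. A / lang.S27 and the dictionary -/

/-- **Deligne's theorem in `ℚ̄_ℓ`-form from Harris–Lan–Taylor–Thorne's Thm. A and the adelic
dictionary for eigenforms.** Hypotheses: `hA` = the existence half of Harris–Lan–Taylor–Thorne's
Thm. A (named fact `HarrisLanTaylorThorne2016.theoremA_existence`); `hcpt` = the compactness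
fact threading the `GL₂/ℚ` automorphy datum; `hdict` = the dictionary: every cuspidal eigenform
`g ∈ S_k(Γ₁(M), χ)`, `k ≥ 2`, of the `T_p` (`p ∤ M`, eigenvalues `a_p`) gives a regular algebraic
cuspidal automorphic representation `π` of `GL₂(𝔸_ℚ)` with Satake parameter
`{(√p β₁)⁻¹, (√p β₂)⁻¹}` at every `p ∤ M`, `β_{1,2}` the roots of `X² - a_p X + χ(p) p^{k-1}`
(`π = π_g ⊗ (χ⁻¹|·|^{k/2}) ∘ det`; Gelbart 1975, Prop. 3.1, Lemma 3.7; Clozel 1990, §3.5).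
Conclusion: for every such `g`, every `ℓ` and every `ι : ℚ̄_ℓ ≃+* ℂ` a continuous semisimple
`r : Gal(ℚ̄/ℚ) → GL₂(ℚ̄_ℓ)` unramified at `p ∤ M`, `p ≠ ℓ`, with
`det(X - r(Frob_p)) = X² - ι⁻¹(a_p) X + ι⁻¹(χ(p) p^{k-1})` — Deligne's theorem (Deligne–Serre
1974, Thm. 6.1) read in `ℚ̄_ℓ`, the hypothesis of `thm67_weightOne_of_deligne_padicAlgCl'`.
Proof: lang.S27 over `ℚ` from `hA` (`exists_galoisRep_of_regularAlgebraic_rat_of`) applied to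
`π`, `ℓ ∉ w` for `p_w ≠ ℓ`, and `arithFrobPolyOfSatake_heckeRoots`.
[cite: HarrisLanTaylorThorneRMS2016, Thm. A (p. 3)] [cite: DeligneSerreASENS1974, Thm. 6.1 (p. 520)] -/
theorem deligne_padicAlgCl_of_theoremA_of_dictionary
    (hA : HarrisLanTaylorThorne2016.theoremA_existence)
    (hcpt : isCompact_glFiniteIntegralLevel 2 ℚ)
    (hdict : ∀ (M : ℕ) [NeZero M] (k : ℤ), 2 ≤ k →
      ∀ (g : CuspForm (Gamma1 M) k) (χ : DirichletCharacter ℂ M),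
        g ∈ nebentypusSubspace M k χ → g ≠ 0 →
      ∀ (a : ℕ → ℂ),
        (∀ (p : ℕ) (hp : p.Prime), ¬ p ∣ M →
          (haveI : NeZero p := ⟨hp.ne_zero⟩; heckeT (Gamma1 M) k p g) = a p • g) →
      ∃ π : CuspidalAutomorphicRepData 2 ℚ hcpt, π.1.IsRegularAlgebraic ∧
        ∀ w : HeightOneSpectrum (𝓞 ℚ), ¬ ((primesEquiv w : Nat.Primes) : ℕ) ∣ M →
          π.1.HasSatakeParamAt w
            ((X ^ 2 - C (a ((primesEquiv w : Nat.Primes) : ℕ)) * X +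
                C (χ ((primesEquiv w : Nat.Primes) : ℕ) *
                  (((primesEquiv w : Nat.Primes) : ℕ) : ℂ) ^ (k - 1)) : ℂ[X]).roots.map
              fun β ↦ (((Real.sqrt ((primesEquiv w : Nat.Primes) : ℕ) : ℝ) : ℂ) * β)⁻¹))
    (M : ℕ) [NeZero M] (k : ℤ) (hk : 2 ≤ k)
    (g : CuspForm (Gamma1 M) k) (χ : DirichletCharacter ℂ M)
    (hg : g ∈ nebentypusSubspace M k χ) (hg0 : g ≠ 0) (a : ℕ → ℂ)
    (haT : ∀ (p : ℕ) (hp : p.Prime), ¬ p ∣ M →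
      (haveI : NeZero p := ⟨hp.ne_zero⟩; heckeT (Gamma1 M) k p g) = a p • g)
    (ℓ : ℕ) [Fact ℓ.Prime] (ι : PadicAlgCl ℓ ≃+* ℂ) :
    ∃ r : GaloisRepresentations.FramedGaloisRep ℚ (PadicAlgCl ℓ) 2,
      r.toGaloisRep.IsSemisimple ∧
      ∀ w : HeightOneSpectrum (𝓞 ℚ), ¬ ((primesEquiv w : Nat.Primes) : ℕ) ∣ M →
        ((primesEquiv w : Nat.Primes) : ℕ) ≠ ℓ →
        r.IsUnramifiedAt w ∧
        r.HasFrobCharpolyAt w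
          (X ^ 2 - C (ι.symm (a ((primesEquiv w : Nat.Primes) : ℕ))) * X +
            C (ι.symm (χ ((primesEquiv w : Nat.Primes) : ℕ) *
              (((primesEquiv w : Nat.Primes) : ℕ) : ℂ) ^ (k - 1)))) := by
  have hℓ : ℓ.Prime := Fact.out
  obtain ⟨π, hπ, hSat⟩ := hdict M k hk g χ hg hg0 a haT
  obtain ⟨r, hrss, hr⟩ := exists_galoisRep_of_regularAlgebraic_rat_of hA hcpt π hπ ℓ ι
  refine ⟨r, hrss, fun w hw hwℓ ↦ ?_⟩
  set p : ℕ := ((primesEquiv w : Nat.Primes) : ℕ) with hpdef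
  have hp : p.Prime := (primesEquiv w).2
  have hℓw : ((ℓ : ℕ) : 𝓞 ℚ) ∉ w.asIdeal := natCast_not_mem_asIdeal_of_primesEquiv_ne hℓ hwℓ
  obtain ⟨hunr, hchar⟩ := hr w _ (hSat w hw) hℓw
  refine ⟨hunr, ?_⟩
  have hq : w.residueCard = p := by
    rw [Rat.residueCard_eq_natGenerator]
    rfl
  have hmonic : ((X ^ 2 - C (a p) * X + C (χ p * (p : ℂ) ^ (k - 1)) : ℂ[X])).Monic := by
    monicity!
  rw [hq, arithFrobPolyOfSatake_heckeRoots ι hp.pos hmonic] at hchar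
  simpa only [Polynomial.map_add, Polynomial.map_sub, Polynomial.map_mul, Polynomial.map_pow,
    Polynomial.map_X, Polynomial.map_C, RingEquiv.toRingHom_eq_coe, RingHom.coe_coe] using hchar

/-- **Deligne's theorem in `ℚ̄_ℓ`-form from lang.S27 and the adelic dictionary.** As
`deligne_padicAlgCl_of_theoremA_of_dictionary`, with Harris–Lan–Taylor–Thorne's Thm. A replaced
by the tree's named fact lang.S27 (`exists_galoisRep_of_regularAlgebraic`, `ℚ` totally real).
[cite: HarrisLanTaylorThorneRMS2016, Thm. A (p. 3)] [cite: DeligneSerreASENS1974, Thm. 6.1 (p. 520)] -/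
theorem deligne_padicAlgCl_of_langS27_of_dictionary
    (h27 : exists_galoisRep_of_regularAlgebraic)
    (hcpt : isCompact_glFiniteIntegralLevel 2 ℚ)
    (hdict : ∀ (M : ℕ) [NeZero M] (k : ℤ), 2 ≤ k →
      ∀ (g : CuspForm (Gamma1 M) k) (χ : DirichletCharacter ℂ M),
        g ∈ nebentypusSubspace M k χ → g ≠ 0 →
      ∀ (a : ℕ → ℂ),
        (∀ (p : ℕ) (hp : p.Prime), ¬ p ∣ M →
          (haveI : NeZero p := ⟨hp.ne_zero⟩; heckeT (Gamma1 M) k p g) = a p • g) →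
      ∃ π : CuspidalAutomorphicRepData 2 ℚ hcpt, π.1.IsRegularAlgebraic ∧
        ∀ w : HeightOneSpectrum (𝓞 ℚ), ¬ ((primesEquiv w : Nat.Primes) : ℕ) ∣ M →
          π.1.HasSatakeParamAt w
            ((X ^ 2 - C (a ((primesEquiv w : Nat.Primes) : ℕ)) * X +
                C (χ ((primesEquiv w : Nat.Primes) : ℕ) *
                  (((primesEquiv w : Nat.Primes) : ℕ) : ℂ) ^ (k - 1)) : ℂ[X]).roots.map
              fun β ↦ (((Real.sqrt ((primesEquiv w : Nat.Primes) : ℕ) : ℝ) : ℂ) * β)⁻¹))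
    (M : ℕ) [NeZero M] (k : ℤ) (hk : 2 ≤ k)
    (g : CuspForm (Gamma1 M) k) (χ : DirichletCharacter ℂ M)
    (hg : g ∈ nebentypusSubspace M k χ) (hg0 : g ≠ 0) (a : ℕ → ℂ)
    (haT : ∀ (p : ℕ) (hp : p.Prime), ¬ p ∣ M →
      (haveI : NeZero p := ⟨hp.ne_zero⟩; heckeT (Gamma1 M) k p g) = a p • g)
    (ℓ : ℕ) [Fact ℓ.Prime] (ι : PadicAlgCl ℓ ≃+* ℂ) :
    ∃ r : GaloisRepresentations.FramedGaloisRep ℚ (PadicAlgCl ℓ) 2,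
      r.toGaloisRep.IsSemisimple ∧
      ∀ w : HeightOneSpectrum (𝓞 ℚ), ¬ ((primesEquiv w : Nat.Primes) : ℕ) ∣ M →
        ((primesEquiv w : Nat.Primes) : ℕ) ≠ ℓ →
        r.IsUnramifiedAt w ∧
        r.HasFrobCharpolyAt w
          (X ^ 2 - C (ι.symm (a ((primesEquiv w : Nat.Primes) : ℕ))) * X +
            C (ι.symm (χ ((primesEquiv w : Nat.Primes) : ℕ) *
              (((primesEquiv w : Nat.Primes) : ℕ) : ℂ) ^ (k - 1)))) := by
  have hℓ : ℓ.Prime := Fact.out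
  obtain ⟨π, hπ, hSat⟩ := hdict M k hk g χ hg hg0 a haT
  obtain ⟨r, hrss, hr⟩ := h27 hcpt (Or.inl inferInstance) π hπ ℓ ι
  refine ⟨r, hrss, fun w hw hwℓ ↦ ?_⟩
  set p : ℕ := ((primesEquiv w : Nat.Primes) : ℕ) with hpdef
  have hp : p.Prime := (primesEquiv w).2
  have hℓw : ((ℓ : ℕ) : 𝓞 ℚ) ∉ w.asIdeal := natCast_not_mem_asIdeal_of_primesEquiv_ne hℓ hwℓ
  obtain ⟨hunr, hchar⟩ := hr w _ (hSat w hw) hℓw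
  refine ⟨hunr, ?_⟩
  have hq : w.residueCard = p := by
    rw [Rat.residueCard_eq_natGenerator]
    rfl
  have hmonic : ((X ^ 2 - C (a p) * X + C (χ p * (p : ℂ) ^ (k - 1)) : ℂ[X])).Monic := by
    monicity!
  rw [hq, arithFrobPolyOfSatake_heckeRoots ι hp.pos hmonic] at hchar
  simpa only [Polynomial.map_add, Polynomial.map_sub, Polynomial.map_mul, Polynomial.map_pow,
    Polynomial.map_X, Polynomial.map_C, RingEquiv.toRingHom_eq_coe, RingHom.coe_coe] using hchar

end Literature.NumberTheory.EllipticCurves.ModularForms.DeligneSerre1974
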